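import Mathlib.RingTheory.MvPolynomial.MonomialOrder
import Mathlib.Data.Finsupp.MonomialOrder
import Mathlib.Algebra.MvPolynomial.Monad
import HarnessLib

/-!
# Triangular substitutions preserve monic leading terms (the substitution step of the
# reduction lemma of Conneryd–de Rezende–Nordström–Pang–Risse)

Topic `Literature/RingTheory/MvPolynomial`.  The last paragraph of the proof of the reduction
lemma of [CdRNPR] (FOCS 2023 version, Lemma 4.6; = Conneryd–Ghannane–Pang 2025, Lemma 6.8 via
[CdRNPR25, Lemma 6.5]): *"each monomial in `f` affected by the substitution decreases in the
induced order … since `m` was the leading term before the substitution and no variable in `m` was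
substituted, it follows that `m` is the leading term of `f*`."*

We isolate this as a statement about a monomial order `mo` on `R[X_ι]` and an algebra
substitution `x_j ↦ σ_j` (`MvPolynomial.bind₁ σ`) that is TRIANGULAR — `deg σ_j ≼ x_j` for every
`j` (each variable goes to a polynomial whose leading monomial is at most the variable itself:
a smaller variable, a constant, `1 - x_{j'}` with `x_{j'} ≺ x_j`, …):
* `degree_bind₁_monomial_le` — `deg σ(X^β) ≼ β` for every exponent `β`;
* `degree_bind₁_le` — `deg σ(f) ≼ deg f`;
* `degree_bind₁_eq`, `monic_bind₁` — if moreover `σ` FIXES the variables of the leading monomial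
  of a MONIC `f`, then `σ(f)` has the same leading exponent and is monic.

## References

* [ConnerydGhannanePang2025] arXiv:2511.17272, Lemma 6.8 (= [CdRNPR25, Lemma 6.5]); the argument
  is printed in J. Conneryd, S. F. de Rezende, J. Nordström, S. Pang, K. Risse, *Graph Colouring Is
  Hard on Average for Polynomial Calculus and Nullstellensatz*, FOCS 2023, proof of Lemma 4.6
  (READ, galaxy pdf:3983998057739619720).
-/

noncomputable section

open MvPolynomial Finset
open scoped MonomialOrder

namespace Literature.RingTheory.MvPolynomial

variable {ι : Type*} {R : Type*} [CommRing R] (mo : MonomialOrder ι)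

/-- A substitution `σ` is TRIANGULAR for `mo` if the leading exponent of every `σ_j` is at most
`x_j`. [cite: ConnerydGhannanePang2025, Lemma 6.8 (proof, via [CdRNPR25, Lemma 6.5])] -/
def IsTriangular (σ : ι → MvPolynomial ι R) : Prop :=
  ∀ j, mo.degree (σ j) ≼[mo] Finsupp.single j 1

variable {mo}

/-- A triangular substitution does not increase the leading exponent of a monomial:
`deg (∏_j σ_j^{β_j}) ≼ β`. [folklore] -/
theorem degree_bind₁_monomial_le {σ : ι → MvPolynomial ι R} (hσ : IsTriangular mo σ)
    (β : ι →₀ ℕ) (c : R) : mo.degree (bind₁ σ (monomial β c)) ≼[mo] β := by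
  classical
  rw [bind₁_monomial]
  refine le_trans mo.degree_mul_le ?_
  rw [mo.degree_C, zero_add]
  refine le_trans mo.degree_prod_le ?_
  have hβ : mo.toSyn β = ∑ j ∈ β.support, mo.toSyn (β j • Finsupp.single j 1) := by
    rw [← map_sum]
    congr 1
    conv_lhs => rw [← Finsupp.sum_single β]
    simp only [Finsupp.sum, Finsupp.smul_single_one]
  rw [map_sum, hβ]
  refine Finset.sum_le_sum fun j _ => ?_
  refine le_trans (mo.degree_pow_le (β j)) ?_
  rw [map_nsmul, map_nsmul]
  exact nsmul_le_nsmul_right (hσ j) (β j)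

/-- A triangular substitution does not increase leading exponents: `deg σ(f) ≼ deg f`. [folklore] -/
theorem degree_bind₁_le {σ : ι → MvPolynomial ι R} (hσ : IsTriangular mo σ)
    (f : MvPolynomial ι R) : mo.degree (bind₁ σ f) ≼[mo] mo.degree f := by
  classical
  conv_lhs => rw [f.as_sum]
  rw [map_sum]
  refine le_trans mo.degree_sum_le (Finset.sup_le fun β hβ => ?_)
  exact le_trans (degree_bind₁_monomial_le hσ β _) (mo.le_degree hβ)

/-- A substitution fixing the variables of `α` fixes `X^α`. [folklore] -/
theorem bind₁_monomial_of_forall_eq_X {σ : ι → MvPolynomial ι R} {α : ι →₀ ℕ}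
    (hfix : ∀ j ∈ α.support, σ j = X j) (c : R) : bind₁ σ (monomial α c) = monomial α c := by
  classical
  rw [bind₁_monomial, Finset.prod_congr rfl fun j hj => by rw [hfix j hj], prod_X_pow_eq_monomial,
    C_mul_monomial, mul_one]

/-- **Triangular substitutions preserve monic leading terms.**  If `f` is monic for `mo`, `σ` is
triangular and fixes the variables of the leading monomial of `f`, then `σ(f)` has the same
leading exponent as `f` … [cite: ConnerydGhannanePang2025, Lemma 6.8 (proof, via [CdRNPR25, Lemma 6.5])] -/
theorem degree_bind₁_eq {σ : ι → MvPolynomial ι R} (hσ : IsTriangular mo σ) {f : MvPolynomial ι R}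
    (hf : mo.Monic f) (hfix : ∀ j ∈ (mo.degree f).support, σ j = X j) :
    mo.degree (bind₁ σ f) = mo.degree f ∧ mo.Monic (bind₁ σ f) := by
  classical
  nontriviality R
  set α := mo.degree f with hα
  -- split off the leading term
  set g := f - monomial α 1 with hg
  have hf' : f = monomial α 1 + g := by rw [hg]; ring
  have hgα : g.coeff α = 0 := by
    rw [hg, coeff_sub, coeff_monomial, if_pos rfl, ← MonomialOrder.leadingCoeff, hf.leadingCoeff_eq_one,
      sub_self]
  -- every exponent of `g` is `≺ α`
  have hglt : ∀ β ∈ g.support, mo.toSyn β < mo.toSyn α := by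
    intro β hβ
    rw [mem_support_iff] at hβ
    have hβα : β ≠ α := fun h => hβ (h ▸ hgα)
    have hβf : β ∈ f.support := by
      rw [mem_support_iff]
      intro h0
      apply hβ
      rw [hg, coeff_sub, h0, coeff_monomial, if_neg (Ne.symm hβα), sub_zero]
    exact lt_of_le_of_ne (mo.le_degree hβf) fun h => hβα (mo.toSyn.injective h)
  -- the substituted tail stays `≺ α`
  have htail : ∀ γ ∈ (bind₁ σ g).support, mo.toSyn γ < mo.toSyn α := by
    intro γ hγ
    have h1 : mo.toSyn γ ≤ mo.toSyn (mo.degree (bind₁ σ g)) := mo.le_degree hγ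
    have h2 : mo.toSyn (mo.degree (bind₁ σ g)) ≤ g.support.sup fun β => mo.toSyn β := by
      conv_lhs => rw [g.as_sum, map_sum]
      refine le_trans mo.degree_sum_le (Finset.sup_mono_fun fun β _ => ?_)
      exact degree_bind₁_monomial_le hσ β _
    have hne : g.support.Nonempty := by
      rw [Finset.nonempty_iff_ne_empty, Ne, support_eq_empty]
      intro h0
      rw [h0, map_zero] at hγ
      simp at hγ
    have h3 : (g.support.sup fun β => mo.toSyn β) < mo.toSyn α :=
      (Finset.sup_lt_iff (lt_of_le_of_lt bot_le (hglt _ hne.choose_spec))).2 hglt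
    exact lt_of_le_of_lt (h1.trans h2) h3
  have hlead : bind₁ σ f = monomial α 1 + bind₁ σ g := by
    rw [hf', map_add, bind₁_monomial_of_forall_eq_X hfix]
  -- conclude with the dominating-exponent characterisation
  have hcoeff : (bind₁ σ f).coeff α = 1 := by
    rw [hlead, coeff_add, coeff_monomial, if_pos rfl]
    have : (bind₁ σ g).coeff α = 0 := by
      by_contra h
      exact lt_irrefl _ (htail α (mem_support_iff.2 h))
    rw [this, add_zero]
  have hsupp : ∀ γ ∈ (bind₁ σ f).support, mo.toSyn γ ≤ mo.toSyn α := by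
    intro γ hγ
    rw [hlead] at hγ
    rcases Finset.mem_union.1 (support_add hγ) with h | h
    · rw [support_monomial, if_neg one_ne_zero, Finset.mem_singleton] at h
      rw [h]
    · exact le_of_lt (htail γ h)
  have hdeg : mo.degree (bind₁ σ f) = α :=
    mo.toSyn.injective (le_antisymm (mo.degree_le_iff.2 hsupp)
      (mo.le_degree (mem_support_iff.2 (by rw [hcoeff]; exact one_ne_zero))))
  exact ⟨hdeg, by rw [MonomialOrder.Monic, MonomialOrder.leadingCoeff, hdeg, hcoeff]⟩

/-- … and is monic. [cite: ConnerydGhannanePang2025, Lemma 6.8 (proof, via [CdRNPR25, Lemma 6.5])] -/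
theorem monic_bind₁ {σ : ι → MvPolynomial ι R} (hσ : IsTriangular mo σ) {f : MvPolynomial ι R}
    (hf : mo.Monic f) (hfix : ∀ j ∈ (mo.degree f).support, σ j = X j) : mo.Monic (bind₁ σ f) :=
  (degree_bind₁_eq hσ hf hfix).2

/-! ### Recognising triangular substitutions -/

/-- `x_j ↦ x_j` is allowed. [folklore] -/
theorem degree_X_le_single (j : ι) : mo.degree (X j : MvPolynomial ι R) ≼[mo] Finsupp.single j 1 :=
  mo.degree_X_le_single

/-- `x_j ↦ c` (a constant) is allowed. [folklore] -/
theorem degree_C_le_single (c : R) (j : ι) :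
    mo.degree (C c : MvPolynomial ι R) ≼[mo] Finsupp.single j 1 := by
  rw [mo.degree_C, map_zero]; exact bot_le

/-- `x_j ↦ x_{j'}` with `x_{j'} ≼ x_j` is allowed. [folklore] -/
theorem degree_X_le_single_of_le {j j' : ι} (h : Finsupp.single j' 1 ≼[mo] Finsupp.single j 1) :
    mo.degree (X j' : MvPolynomial ι R) ≼[mo] Finsupp.single j 1 :=
  le_trans mo.degree_X_le_single h

/-- `x_j ↦ 1 - x_{j'}` with `x_{j'} ≼ x_j` is allowed. [folklore] -/
theorem degree_one_sub_X_le_single {j j' : ι} (h : Finsupp.single j' 1 ≼[mo] Finsupp.single j 1) :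
    mo.degree (1 - X j' : MvPolynomial ι R) ≼[mo] Finsupp.single j 1 := by
  refine le_trans mo.degree_sub_le (sup_le ?_ (le_trans mo.degree_X_le_single h))
  rw [mo.degree_one, map_zero]; exact bot_le

/-! ### Evaluation of a substitution and the lexicographic order of variables -/

/-- Evaluating `σ(f)` at `y` is evaluating `f` at the point `j ↦ σ_j(y)`. [folklore] -/
theorem eval_bind₁_apply (σ : ι → MvPolynomial ι R) (f : MvPolynomial ι R) (y : ι → R) :
    eval y (bind₁ σ f) = eval (fun j => eval y (σ j)) f :=
  eval₂Hom_bind₁ _ _ _ _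

/-- In the lexicographic order a variable with a LARGER index is SMALLER: `j < j'` gives
`x_{j'} ≺ x_j`. [folklore] -/
theorem lex_single_lt_single [LinearOrder ι] [WellFoundedGT ι] {j j' : ι} (h : j < j') :
    Finsupp.single j' 1 ≺[MonomialOrder.lex] Finsupp.single j 1 := by
  rw [MonomialOrder.lex_lt_iff]
  refine Finsupp.Lex.lt_iff.2 ⟨j, fun k hk => ?_, ?_⟩
  · change Finsupp.single j' 1 k = Finsupp.single j 1 k
    rw [Finsupp.single_eq_of_ne (ne_of_gt (hk.trans h)).symm,
      Finsupp.single_eq_of_ne (ne_of_gt hk).symm]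
  · change Finsupp.single j' 1 j < Finsupp.single j 1 j
    rw [Finsupp.single_eq_of_ne (ne_of_lt h), Finsupp.single_eq_same]
    exact Nat.one_pos

end Literature.RingTheory.MvPolynomial
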